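import Mathlib
import Summits.Ventures.HodgeRepro.Tier4.Common.CompactOpenLevel
import Summits.Ventures.HodgeRepro.Tier4.Line1.ArchMatrixCoeff

/-!
# Tier4/Line1/FinLevelCompact — (S1b-INST) without the level-function binder: `K_f(N) × G(k_∞)` is COMPACT when the
archimedean image of `U(W)(𝔸_k)` is, and then `1_{K_f(N) × G(k_∞)} · (archMat ·) i j` is a genuine test pair

Blind re-derivation cell `pub-hodge-repro`, Tier 4 (README §9–§10), seat t4-L1-p2 (gen 4), LINE L1.  Target tree path
`lean/Summits/Ventures/HodgeRepro/Tier4/Line1/FinLevelCompact.lean`.  Imports typer-2's `CompactOpenLevel`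
(`infPart`, `finPart`, `integralSet`, `isCompact_integralSet`, `modSet_subset_integral`, `add_mem_integralSet`,
`finPart_one_apply_mem`, `isClosedEmbedding_embed`) and this seat's `ArchMatrixCoeff` (`finLevel`, `IsCongrFin`,
`isOpen_finLevel`, `archMat`, `isTest_indicator_of_compactOpen`, `indicator_left_invariant`, `exists_spec_of_archCoeff`).

WHAT THIS IS.  `ArchMatrixCoeff.exists_spec_of_archCoeff` proves (S1b) for the pairs «level-`N` function `ψ` ×
archimedean matrix coefficient» with the level function `ψ` a BINDER (a left-`finLevel`-invariant test function).  A
non-zero such `ψ` exists exactly when `finLevel W N = K_f(N) × G(k_∞)` is compact, i.e. when the archimedean group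
`G(k_∞)` is.  This file proves the compactness from ONE displayed property of the plane:

* `archImage W` — the set of archimedean parts `infPartMat (GA.mat W g)` of the elements of `U(W)(𝔸_k)` (a subset of
  `M₄(k_∞) = M₄(∏_w k_w)`); `IsCompact (archImage W)` is the honest typed form of «`G(k_∞)` is compact» (the totally
  definite plane: definiteness at EVERY real place — the tree's `IsDefinite W` is definiteness at ONE place, so this is
  a further hypothesis of the plane, displayed, never derived here).
* THEOREM `isCompact_finLevel_of_subset (hC : IsCompact C) (hsub : archImage W ⊆ C) (hN : N ≠ 0) : IsCompact (finLevel W N)`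
  (and `isCompact_finLevel` with `C = archImage W`) — typer-2's
  proof of `isCompact_levelK` with the archimedean factor of the box replaced by `archImage W`: under the closed embedding
  `g ↦ (g, g⁻¹)` of `U(W)(𝔸_k)` into `M₄(𝔸_k) × M₄(𝔸_k)ᵐᵒᵖ`, `finLevel W N` lies in the preimage of the compact
  `box × op '' box`, `box := zip '' (C ×ˢ ∏ 𝓞_v)` (a continuous image of a product of compacts), and is
  closed (an open subgroup is closed).  The `⊆ C` form is the one a totally-definite-plane theorem feeds: entrywise
  bounds on the archimedean components give a compact superset of `archImage W` without proving the image closed.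
* COROLLARIES: `isTest_indicator_finLevel` — `1_{finLevel W N}` is a left-`finLevel`-invariant TEST function;
  `hasFiniteRankLeftType_indicator_archCoeff`; and on `Setting.ofAdelic` **`exists_spec_of_archCoeff_indicator`**: for
  the test pairs `(1_{K_f(N γ) × G(k_∞)} · (archMat pl (w γ) ·) (i γ) (j γ), f₂)` — the Hecke pair «spherical of level
  `N γ` at the finite places, standard type at the infinite place `w γ`», with NO binder beyond the plane's compactness —
  every Hecke choice has a FINITE spectrum.  This is (S1b) on L1's instance for a fully concrete family.

JUNK TESTS.  `N = 0`: guarded (`hN`).  `archImage W` compact is FALSE on an indefinite plane (a hyperbolic rotation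
of unbounded entries at a real place lies in the image) — the hypothesis has content and is not vacuous: on a totally
definite plane the archimedean group is a compact orthogonal group, so `archImage W` IS compact (a typer-size theorem
not in the tree — not claimed).  The pair `(1_{finLevel} · entry, f₂)` is non-zero: `1_{finLevel}` is `1` on the
identity and `archMat W w 1 = 1` has a non-zero `(i, i)` entry.

NOT claimed: compactness of `archImage W` from definiteness, the seesaw identity (S1a), the dictionary `tf`, (S3′),
`P_T4`.  0 print.  Nothing here says anything about the status of the Hodge conjecture for CM abelian varieties, which
is NOT proved (HC_CM is NOT proved by anyone in this repository).
-/

set_option autoImplicit false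

noncomputable section

namespace Summit.Ventures.HodgeRepro.Tier4.Line1

open NumberField IsDedekindDomain Common MeasureTheory Topology

section ArchImage

variable (k : Type) [Field k] [NumberField k]

/-- the archimedean part of an adelic `4 × 4` matrix, entrywise. -/
def infPartMat (A : M4 k) : Matrix (Fin 4) (Fin 4) (InfiniteAdeleRing k) := A.map (infPart k)

/-- the finite part of an adelic `4 × 4` matrix, entrywise. -/
def finPartMat (A : M4 k) : Matrix (Fin 4) (Fin 4) (FiniteAdeleRing (𝓞 k) k) := A.map (finPart k)

/-- an adelic matrix from its archimedean and finite parts (entrywise pairs). -/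
def zipMat (P : Matrix (Fin 4) (Fin 4) (InfiniteAdeleRing k)) (Q : Matrix (Fin 4) (Fin 4) (FiniteAdeleRing (𝓞 k) k)) :
    M4 k := Matrix.of fun i j => (P i j, Q i j)

/-- every adelic matrix is the zip of its two parts. -/
theorem zipMat_infPartMat_finPartMat (A : M4 k) : zipMat k (infPartMat k A) (finPartMat k A) = A := by
  ext i j
  rfl

/-- `zipMat` is continuous (entrywise pairing). -/
theorem continuous_zipMat : Continuous fun p : Matrix (Fin 4) (Fin 4) (InfiniteAdeleRing k) ×
    Matrix (Fin 4) (Fin 4) (FiniteAdeleRing (𝓞 k) k) => zipMat k p.1 p.2 := by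
  unfold zipMat
  refine continuous_pi fun i => continuous_pi fun j => ?_
  exact (continuous_fst.matrix_elem i j).prodMk (continuous_snd.matrix_elem i j)

/-- the box of integral finite parts: `∏_{i j} ∏_v 𝓞_v`. -/
def intBox : Set (Matrix (Fin 4) (Fin 4) (FiniteAdeleRing (𝓞 k) k)) :=
  Set.pi Set.univ fun _ => Set.pi Set.univ fun _ => integralSet k

/-- the integral box is compact (Tychonoff on typer-2's `isCompact_integralSet`). -/
theorem isCompact_intBox : IsCompact (intBox k) :=
  isCompact_univ_pi fun _ => isCompact_univ_pi fun _ => isCompact_integralSet k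

variable {k} (W : PlaneData k)

/-- **the archimedean image of `U(W)(𝔸_k)`**: the archimedean parts of its elements, a subset of `M₄(k_∞)`.
`IsCompact (archImage W)` is the typed form of «`G(k_∞)` is compact» (the totally definite plane). -/
def archImage : Set (Matrix (Fin 4) (Fin 4) (InfiniteAdeleRing k)) :=
  Set.range fun g : GA W => infPartMat k (GA.mat W g)

/-- the archimedean part of an element of `U(W)(𝔸_k)` lies in the archimedean image. -/
theorem infPartMat_mem_archImage (g : GA W) : infPartMat k (GA.mat W g) ∈ archImage W := ⟨g, rfl⟩

/-- the box `zip '' (C ×ˢ intBox)` of adelic matrices with archimedean part in `C` and integral finite part. -/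
def archBox (C : Set (Matrix (Fin 4) (Fin 4) (InfiniteAdeleRing k))) : Set (M4 k) :=
  (fun p => zipMat k p.1 p.2) '' (C ×ˢ intBox k)

/-- the box is compact when `C` is. -/
theorem isCompact_archBox {C : Set (Matrix (Fin 4) (Fin 4) (InfiniteAdeleRing k))} (hC : IsCompact C) :
    IsCompact (archBox C) :=
  (hC.prod (isCompact_intBox k)).image (continuous_zipMat k)

/-- the finite part of an entry of a matrix `≡ 1 (mod N)` in the finite components is integral. -/
theorem finPart_mem_integral_of_isCongrFin {N : ℕ} {A : M4 k} (hA : IsCongrFin k N A) (i j : Fin 4) :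
    finPart k (A i j) ∈ integralSet k := by
  have h := hA i j
  rw [mem_finCongrSet] at h
  have hA' : finPart k (A i j) = finPart k ((A - 1) i j) + finPart k ((1 : M4 k) i j) := by
    rw [Matrix.sub_apply, map_sub, sub_add_cancel]
  rw [hA']
  exact add_mem_integralSet (modSet_subset_integral k N h) (finPart_one_apply_mem i j)

/-- the matrix of an element of `U(W)(𝔸_k)` congruent to `1 (mod N)` in the finite components lies in the box over
any `C ⊇ archImage W`. -/
theorem mat_mem_archBox {C : Set (Matrix (Fin 4) (Fin 4) (InfiniteAdeleRing k))} (hsub : archImage W ⊆ C) {N : ℕ}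
    {g : GA W} (hg : IsCongrFin k N (GA.mat W g)) : GA.mat W g ∈ archBox C := by
  refine ⟨(infPartMat k (GA.mat W g), finPartMat k (GA.mat W g)), ⟨hsub (infPartMat_mem_archImage W g), ?_⟩,
    zipMat_infPartMat_finPartMat k _⟩
  refine Set.mem_univ_pi.2 fun i => Set.mem_univ_pi.2 fun j => ?_
  exact finPart_mem_integral_of_isCongrFin hg i j

/-- `K_f(N) × G(k_∞)` is closed in `U(W)(𝔸_k)` (an open subgroup is closed). -/
theorem isClosed_finLevel {N : ℕ} (hN : N ≠ 0) : IsClosed (finLevel W N : Set (GA W)) :=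
  (finLevel W N).isClosed_of_isOpen (isOpen_finLevel W hN)

/-- **`K_f(N) × G(k_∞)` IS COMPACT when the archimedean image of `U(W)(𝔸_k)` lies in a compact set** (`N ≠ 0`):
a closed subset of the preimage, under the closed embedding `g ↦ (g, g⁻¹)`, of the compact `archBox × op '' archBox`. -/
theorem isCompact_finLevel_of_subset {C : Set (Matrix (Fin 4) (Fin 4) (InfiniteAdeleRing k))} (hC : IsCompact C)
    (hsub : archImage W ⊆ C) {N : ℕ} (hN : N ≠ 0) : IsCompact (finLevel W N : Set (GA W)) := by
  have hP : IsCompact (archBox C ×ˢ (MulOpposite.op '' archBox C)) :=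
    (isCompact_archBox hC).prod ((isCompact_archBox hC).image MulOpposite.continuous_op)
  have hK : IsCompact ((fun g : GA W => Units.embedProduct (M4 k) (g : GL4 k)) ⁻¹'
      (archBox C ×ˢ (MulOpposite.op '' archBox C))) :=
    (isClosedEmbedding_embed W).isCompact_preimage hP
  refine hK.of_isClosed_subset (isClosed_finLevel W hN) ?_
  intro g hg
  obtain ⟨h1, h2⟩ := (mem_finLevel W N g).1 hg
  show Units.embedProduct (M4 k) (g : GL4 k) ∈ archBox C ×ˢ (MulOpposite.op '' archBox C)
  rw [Units.embedProduct_apply]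
  exact ⟨mat_mem_archBox W hsub h1, ⟨_, mat_mem_archBox W hsub h2, rfl⟩⟩

/-- **`K_f(N) × G(k_∞)` IS COMPACT when the archimedean image of `U(W)(𝔸_k)` is** (`N ≠ 0`). -/
theorem isCompact_finLevel (hC : IsCompact (archImage W)) {N : ℕ} (hN : N ≠ 0) :
    IsCompact (finLevel W N : Set (GA W)) :=
  isCompact_finLevel_of_subset W hC subset_rfl hN

/-- **`1_{K_f(N) × G(k_∞)}` is a test function** when the archimedean image is compact. -/
theorem isTest_indicator_finLevel (hC : IsCompact (archImage W)) {N : ℕ} (hN : N ≠ 0) :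
    RTF.IsTest (Set.indicator (finLevel W N : Set (GA W)) fun _ => (1 : ℂ)) :=
  isTest_indicator_of_compactOpen (finLevel W N) (isCompact_finLevel W hC hN) (isOpen_finLevel W hN)

/-- `1_{K_f(N) × G(k_∞)} · (archMat W w ·) i j` has a finite-rank left-`finLevel`-type. -/
theorem hasFiniteRankLeftType_indicator_archCoeff (hC : IsCompact (archImage W)) {N : ℕ} (hN : N ≠ 0)
    (w : InfinitePlace k) (i j : Fin 4) :
    RTF.HasFiniteRankLeftType (finLevel W N)
      (RTF.coeffFn (archMat W w) i j (Set.indicator (finLevel W N : Set (GA W)) fun _ => (1 : ℂ))) :=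
  hasFiniteRankLeftType_indicator_coeff (finLevel W N) (isCompact_finLevel W hC hN) (isOpen_finLevel W hN)
    (archMat W w) i j fun l j => continuous_archMat_entry W w l j

end ArchImage

section Instance

variable {k : Type} [Field k] [NumberField k] (pl : PlaneData k) (hdef : IsDefinite pl) (hgen : IsGenuineRow pl)
  [MeasurableSpace (GA pl)] [BorelSpace (GA pl)] (R : RTFData pl) (μ : Measure (GA pl)) [μ.IsHaarMeasure]
  [R.μT.IsHaarMeasure] [R.μT'.IsHaarMeasure] (hT : IsCompact (closure R.DT)) (hT' : IsCompact (closure R.DT'))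
  {τ : ℕ → Set (GA pl → ℂ)} {φ : ℕ → GA pl → ℂ} {n : ℕ → ℕ}
  {Form : Type} [AddCommGroup Form] [Module ℂ Form] {A : FormAlgebra Form} {Wt : Witness A}

/-- **(S1b) FOR THE CONCRETE PAIRS «`1_{K_f(N γ) × G(k_∞)}` × archimedean matrix coefficient» on L1's instance** (the
theorem of record of this file): on a plane with compact archimedean image, if every first test is
`1_{finLevel pl (N γ)} · (archMat pl (w γ) ·) (i γ) (j γ)` with `N γ ≠ 0`, every Hecke choice has a finite spectrum —
no binder beyond `hC`. -/
theorem exists_spec_of_archCoeff_indicator (hC : IsCompact (archImage pl))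
    (hB : (Setting.ofAdelic pl hdef hgen R μ hT hT').IsAdaptedONB τ φ n)
    (tf : Wt.Translates → (GA pl → ℂ) × (GA pl → ℂ)) (N : Wt.Translates → ℕ) (hN : ∀ γ, N γ ≠ 0)
    (w : Wt.Translates → InfinitePlace k) (i j : Wt.Translates → Fin 4)
    (htf : ∀ γ, (tf γ).1 = RTF.coeffFn (archMat pl (w γ)) (i γ) (j γ)
      (Set.indicator (finLevel pl (N γ) : Set (GA pl)) fun _ => (1 : ℂ))) :
    ∃ spec : Wt.Translates → Finset ℕ,
      FiniteSpectrum (Setting.ofAdelic pl hdef hgen R μ hT hT') R.chi R.chi' φ n tf spec :=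
  exists_spec_of_archCoeff pl hdef hgen R μ hT hT' hB tf N hN w i j
    (fun γ => Set.indicator (finLevel pl (N γ) : Set (GA pl)) fun _ => (1 : ℂ))
    (fun γ => isTest_indicator_finLevel pl hC (hN γ)) (fun γ => indicator_left_invariant (finLevel pl (N γ))) htf

end Instance

end Summit.Ventures.HodgeRepro.Tier4.Line1

end
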